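import Summits.CriticalPhenomena.PercolationContinuityZ3.Theorems.PercNearOneGluingNoHeavyLowerTailSahiTransportSections

/-!
# `NoHeavyLowerTail` (crux stmt-CriticalPhenomena-4575), Sahi / Kahn positivity: TRANSPORT CERTIFICATES for a junta first slot (II) —
# the cone lemma, the certificate, and the extension theorem

Support file (cell `prim-l12`, seat P3, gen 4; `--supports stmt-CriticalPhenomena-4575`).  No `sorry`, no named facts, standard axioms.  New mathematics.
Part I (`…SahiTransportSections`) proved the identity `E₃(1_H,1_U,1_V) = E₃^{cube}(1_{H_k}; f, g) + Σ_S w(S)(2·1_{H_k}(S) − θ)c(S)` over the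
outer sections of the two free slots.  Here:
* `remForm` — the bilinear remainder `B_Π(f,g) = E₃^{cube}(1_{H_k};f,g) − Σ Π(S,T)(f(T)g(T) − f(S)g(S))`, its linearity and symmetry;
* `cone_of_upperSet` — layer-cake induction: a linear functional nonnegative on up-set indicators of the pattern cube is nonnegative on every
  increasing nonnegative pattern function; hence `remForm_nonneg_of_ind`;
* `remForm_ind` — `B_Π` on a pair of up-set indicators in closed form (the transport condition (TC));
* `TransportCert q Hk Π` — a nonnegative kernel on `{S ⊆ T, S ∉ Hk, T ∈ Hk}` with row sums `θ w(S)`, column sums `≤ (2−θ)w(T)` and (TC):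
  `Σ_S Σ_{T∈𝒳∩𝒵} Π(S,T) ≤ (2−θ)[w(𝒳∩𝒵) − w(𝒳)w(𝒵) − w(Hkᶜ∩𝒳∩𝒵)] + w(𝒳)w(Hkᶜ∩𝒵) + w(𝒵)w(Hkᶜ∩𝒳)` for all up-sets `𝒳, 𝒵` of `2^{Fin k}`;
* **`sahiE_three_nonneg_of_transportCert`** — a certificate for the pattern event of a block-determined increasing `H` gives
  `E₃(1_H, 1_U, 1_V) ≥ 0` for ALL increasing `U, V` in every dimension (transport of the negative outer-covariance mass + the cone lemma).
For `k = 3` the condition (TC) is `210` polynomial inequalities in `(p_a,p_b,p_c)`; explicit certificates for the types `a ∨ bc` and majority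
are verified in the companion files, completing Kahn's Conjecture 5 for a first slot depending on at most three coordinates. [this work]
-/

noncomputable section

open scoped Classical

namespace Summit.CriticalPhenomena.PercolationContinuityZ3.Theorems

namespace SahiTransportCert

open Finset
open SahiHittingSlot
open Literature.Combinatorics.Sahi2008
open Literature.Probability.Percolation (DeterminedBy determinedBy_iff)
open Literature.Probability.Percolation.BHK2006 (weight weight_nonneg harris blockFubini ind_inter)
open Literature.Probability.Percolation.DecisionTree (ind ind_of_mem ind_of_not_mem ind_nonneg)

variable {ι : Type} [Fintype ι] {k : ℕ}

/-! ### The bilinear remainder and the cone lemma -/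

/-- The bilinear remainder `B_Π(f,g) = E₃^{cube}(1_{H_k}; f, g) − Σ_{S,T} Π(S,T)(f(T)g(T) − f(S)g(S))`. [this work] -/
def remForm (q : Fin k → unitInterval) (Hk : Set (Set (Fin k))) (Kr : Set (Fin k) → Set (Fin k) → ℝ) (f g : Set (Fin k) → ℝ) : ℝ :=
  cubeForm q Hk f g - ∑ S, ∑ T, Kr S T * (f T * g T - f S * g S)

/-- `B_Π` is linear in the first slot. [this work] -/
theorem remForm_add_smul_left (q : Fin k → unitInterval) (Hk : Set (Set (Fin k))) (Kr : Set (Fin k) → Set (Fin k) → ℝ)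
    (f f' g : Set (Fin k) → ℝ) (a : ℝ) :
    remForm q Hk Kr (f + a • f') g = remForm q Hk Kr f g + a * remForm q Hk Kr f' g := by
  unfold remForm cubeForm
  simp only [Pi.add_apply, Pi.smul_apply, smul_eq_mul]
  have e1 : ∀ (F G : Set (Fin k) → ℝ), ∑ S, bernoulliWeight q S * (F S + G S) =
      ∑ S, bernoulliWeight q S * F S + ∑ S, bernoulliWeight q S * G S := fun F G => by
    rw [← sum_add_distrib]; exact sum_congr rfl fun S _ => by ring
  have e2 : ∀ (F : Set (Fin k) → ℝ) (b : ℝ), ∑ S, bernoulliWeight q S * (b * F S) = b * ∑ S, bernoulliWeight q S * F S := fun F b => by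
    rw [mul_sum]; exact sum_congr rfl fun S _ => by ring
  have eA : ∑ S, bernoulliWeight q S * (ind Hk S * ((f S + a * f' S) * g S)) =
      ∑ S, bernoulliWeight q S * (ind Hk S * (f S * g S)) + a * ∑ S, bernoulliWeight q S * (ind Hk S * (f' S * g S)) := by
    rw [mul_sum, ← sum_add_distrib]; exact sum_congr rfl fun S _ => by ring
  have eB : ∑ S, bernoulliWeight q S * ((f S + a * f' S) * g S) =
      ∑ S, bernoulliWeight q S * (f S * g S) + a * ∑ S, bernoulliWeight q S * (f' S * g S) := by
    rw [mul_sum, ← sum_add_distrib]; exact sum_congr rfl fun S _ => by ring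
  have eC : ∑ S, bernoulliWeight q S * (f S + a * f' S) =
      ∑ S, bernoulliWeight q S * f S + a * ∑ S, bernoulliWeight q S * f' S := by
    rw [mul_sum, ← sum_add_distrib]; exact sum_congr rfl fun S _ => by ring
  have eD : ∑ S, bernoulliWeight q S * (ind Hk S * (f S + a * f' S)) =
      ∑ S, bernoulliWeight q S * (ind Hk S * f S) + a * ∑ S, bernoulliWeight q S * (ind Hk S * f' S) := by
    rw [mul_sum, ← sum_add_distrib]; exact sum_congr rfl fun S _ => by ring
  have eE : ∑ S, ∑ T, Kr S T * ((f T + a * f' T) * g T - (f S + a * f' S) * g S) =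
      ∑ S, ∑ T, Kr S T * (f T * g T - f S * g S) + a * ∑ S, ∑ T, Kr S T * (f' T * g T - f' S * g S) := by
    rw [mul_sum, ← sum_add_distrib]
    refine sum_congr rfl fun S _ => ?_
    rw [mul_sum, ← sum_add_distrib]
    exact sum_congr rfl fun T _ => by ring
  rw [eA, eB, eC, eD, eE]
  ring

/-- `B_Π` is symmetric under exchanging the two pattern functions. [this work] -/
theorem remForm_comm (q : Fin k → unitInterval) (Hk : Set (Set (Fin k))) (Kr : Set (Fin k) → Set (Fin k) → ℝ)
    (f g : Set (Fin k) → ℝ) : remForm q Hk Kr f g = remForm q Hk Kr g f := by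
  unfold remForm cubeForm
  have e1 : ∑ S, bernoulliWeight q S * (ind Hk S * (f S * g S)) = ∑ S, bernoulliWeight q S * (ind Hk S * (g S * f S)) :=
    sum_congr rfl fun S _ => by ring
  have e2 : ∑ S, bernoulliWeight q S * (f S * g S) = ∑ S, bernoulliWeight q S * (g S * f S) := sum_congr rfl fun S _ => by ring
  have e3 : ∑ S, ∑ T, Kr S T * (f T * g T - f S * g S) = ∑ S, ∑ T, Kr S T * (g T * f T - g S * f S) :=
    sum_congr rfl fun S _ => sum_congr rfl fun T _ => by ring
  rw [e1, e2, e3]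
  ring

/-- **Cone lemma** (layer cake): a functional which is linear and nonnegative on indicators of up-sets of the pattern cube is nonnegative on
every increasing nonnegative pattern function. [this work] -/
theorem cone_of_upperSet (φ : (Set (Fin k) → ℝ) → ℝ) (hlin : ∀ f f' a, φ (f + a • f') = φ f + a * φ f')
    (hup : ∀ 𝒳 : Set (Set (Fin k)), IsUpperSet 𝒳 → 0 ≤ φ (ind 𝒳)) :
    ∀ f : Set (Fin k) → ℝ, Monotone f → (∀ S, 0 ≤ f S) → 0 ≤ φ f := by
  have hzero : φ 0 = 0 := by
    have h := hlin 0 0 1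
    simp only [smul_zero, add_zero, one_mul] at h
    linarith
  -- induction on the size of the support
  suffices key : ∀ n : ℕ, ∀ f : Set (Fin k) → ℝ, (Finset.univ.filter fun S => f S ≠ 0).card ≤ n →
      Monotone f → (∀ S, 0 ≤ f S) → 0 ≤ φ f from
    fun f hf hf0 => key _ f le_rfl hf hf0
  intro n
  induction n with
  | zero =>
    intro f hcard _ _
    have hf : f = 0 := by
      funext S
      have : S ∉ Finset.univ.filter fun S => f S ≠ 0 := by
        rw [Nat.le_zero, card_eq_zero] at hcard; rw [hcard]; exact notMem_empty S
      simpa [mem_filter] using this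
    rw [hf, hzero]
  | succ n ih =>
    intro f hcard hmono hf0
    by_cases hempty : (Finset.univ.filter fun S => f S ≠ 0) = ∅
    · exact ih f (by rw [hempty, card_empty]; exact Nat.zero_le _) hmono hf0
    obtain ⟨S₀, hS₀, hmin⟩ := exists_min_image (Finset.univ.filter fun S => f S ≠ 0) f (nonempty_iff_ne_empty.2 hempty)
    have hS₀ne : f S₀ ≠ 0 := (mem_filter.1 hS₀).2
    have hm : 0 < f S₀ := lt_of_le_of_ne (hf0 S₀) (Ne.symm hS₀ne)
    set 𝒳 : Set (Set (Fin k)) := {S | f S ≠ 0} with h𝒳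
    have h𝒳up : IsUpperSet 𝒳 := by
      intro S T hle hS
      have : 0 < f S := lt_of_le_of_ne (hf0 S) (Ne.symm hS)
      exact ne_of_gt (lt_of_lt_of_le this (hmono hle))
    set f' : Set (Fin k) → ℝ := fun S => f S - f S₀ * ind 𝒳 S with hf'
    have hf'val : ∀ S, f' S = if f S = 0 then 0 else f S - f S₀ := by
      intro S
      by_cases h : f S = 0
      · rw [if_pos h, hf']; simp only; rw [h, ind_of_not_mem (show S ∉ 𝒳 from fun h' => h' h)]; ring
      · rw [if_neg h, hf']; simp only; rw [ind_of_mem (show S ∈ 𝒳 from h)]; ring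
    have hf'0 : ∀ S, 0 ≤ f' S := by
      intro S; rw [hf'val]
      by_cases h : f S = 0
      · rw [if_pos h]
      · rw [if_neg h]; exact sub_nonneg.2 (hmin S (mem_filter.2 ⟨mem_univ _, h⟩))
    have hf'mono : Monotone f' := by
      intro S T hle
      rw [hf'val, hf'val]
      by_cases hS : f S = 0
      · rw [if_pos hS]
        by_cases hT : f T = 0
        · rw [if_pos hT]
        · rw [if_neg hT]; exact sub_nonneg.2 (hmin T (mem_filter.2 ⟨mem_univ _, hT⟩))
      · have hT : f T ≠ 0 := h𝒳up hle hS
        rw [if_neg hS, if_neg hT]; exact sub_le_sub_right (hmono hle) _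
    have hcard' : (Finset.univ.filter fun S => f' S ≠ 0).card ≤ n := by
      have hsub : (Finset.univ.filter fun S => f' S ≠ 0) ⊆ (Finset.univ.filter fun S => f S ≠ 0).erase S₀ := by
        intro S hS
        have hS' := (mem_filter.1 hS).2
        rw [mem_erase, mem_filter]
        refine ⟨?_, mem_univ _, ?_⟩
        · rintro rfl; rw [hf'val, if_neg hS₀ne, sub_self] at hS'; exact hS' rfl
        · intro h; rw [hf'val, if_pos h] at hS'; exact hS' rfl
      have := card_le_card hsub
      rw [card_erase_of_mem hS₀] at this
      omega
    have hdecomp : f = f' + f S₀ • ind 𝒳 := by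
      funext S; simp only [hf', Pi.add_apply, Pi.smul_apply, smul_eq_mul]; ring
    rw [hdecomp, hlin]
    exact add_nonneg (ih f' hcard' hf'mono hf'0) (mul_nonneg hm.le (hup 𝒳 h𝒳up))

/-- The cone lemma for the bilinear remainder: nonnegativity on pairs of up-set indicators gives nonnegativity on pairs of increasing
nonnegative pattern functions. [this work] -/
theorem remForm_nonneg_of_ind (q : Fin k → unitInterval) (Hk : Set (Set (Fin k))) (Kr : Set (Fin k) → Set (Fin k) → ℝ)
    (hind : ∀ 𝒳 𝒵 : Set (Set (Fin k)), IsUpperSet 𝒳 → IsUpperSet 𝒵 → 0 ≤ remForm q Hk Kr (ind 𝒳) (ind 𝒵))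
    {f g : Set (Fin k) → ℝ} (hf : Monotone f) (hf0 : ∀ S, 0 ≤ f S) (hg : Monotone g) (hg0 : ∀ S, 0 ≤ g S) :
    0 ≤ remForm q Hk Kr f g := by
  have step1 : ∀ 𝒳 : Set (Set (Fin k)), IsUpperSet 𝒳 → 0 ≤ remForm q Hk Kr g (ind 𝒳) := by
    intro 𝒳 h𝒳
    refine cone_of_upperSet (fun g' => remForm q Hk Kr g' (ind 𝒳)) (fun f₁ f₂ a => remForm_add_smul_left q Hk Kr f₁ f₂ _ a)
      (fun 𝒵 h𝒵 => ?_) g hg hg0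
    rw [remForm_comm]; exact hind 𝒳 𝒵 h𝒳 h𝒵
  refine cone_of_upperSet (fun f' => remForm q Hk Kr f' g) (fun f₁ f₂ a => remForm_add_smul_left q Hk Kr f₁ f₂ _ a) (fun 𝒳 h𝒳 => ?_) f hf hf0
  rw [remForm_comm]; exact step1 𝒳 h𝒳

/-! ### Transport certificates and the main theorem -/

/-- The remainder on a pair of up-set indicators, in closed form: with `𝒦 = 𝒳 ∩ 𝒵`, `θ = w(H_k)`, `D_k = H_kᶜ`,
`B_Π(1_𝒳,1_𝒵) = (2−θ)[w(𝒦) − w(𝒳)w(𝒵) − w(D_k ∩ 𝒦)] + w(𝒳)w(D_k ∩ 𝒵) + w(𝒵)w(D_k ∩ 𝒳) − Σ_{S}Σ_{T ∈ 𝒦} Π(S,T)`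
for a kernel with row sums `θ w(S)` off `H_k` and vanishing rows on `H_k`. [this work] -/
theorem remForm_ind (q : Fin k → unitInterval) (Hk : Set (Set (Fin k))) (Kr : Set (Fin k) → Set (Fin k) → ℝ)
    (hrow : ∀ S, S ∉ Hk → ∑ T, Kr S T = pr q Hk * bernoulliWeight q S) (hrowH : ∀ S, S ∈ Hk → ∀ T, Kr S T = 0)
    (𝒳 𝒵 : Set (Set (Fin k))) :
    remForm q Hk Kr (ind 𝒳) (ind 𝒵) =
      (2 - pr q Hk) * (pr q (𝒳 ∩ 𝒵) - pr q 𝒳 * pr q 𝒵 - pr q (Hkᶜ ∩ (𝒳 ∩ 𝒵)))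
        + pr q 𝒳 * pr q (Hkᶜ ∩ 𝒵) + pr q 𝒵 * pr q (Hkᶜ ∩ 𝒳)
        - ∑ S, ∑ T, Kr S T * ind (𝒳 ∩ 𝒵) T := by
  have hii : ∀ (X Y : Set (Set (Fin k))) (S : Set (Fin k)), ind X S * ind Y S = ind (X ∩ Y) S := fun X Y S => (ind_inter X Y S).symm
  have hc : ∀ (Y : Set (Set (Fin k))) (S : Set (Fin k)), ind Hk S * ind Y S = ind Y S - ind (Hkᶜ ∩ Y) S := by
    intro Y S
    rw [← hii]
    by_cases h : S ∈ Hk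
    · rw [ind_of_mem h, ind_of_not_mem (show S ∉ Hkᶜ from fun h' => h' h)]; ring
    · rw [ind_of_not_mem h, ind_of_mem (show S ∈ Hkᶜ from h)]; ring
  unfold remForm cubeForm
  simp only [hii 𝒳 𝒵]
  have e1 : ∑ S, bernoulliWeight q S * (ind Hk S * ind (𝒳 ∩ 𝒵) S) = pr q (𝒳 ∩ 𝒵) - pr q (Hkᶜ ∩ (𝒳 ∩ 𝒵)) := by
    simp only [hc, mul_sub, sum_sub_distrib, pr_eq_sum]
  have e2 : ∑ S, bernoulliWeight q S * (ind Hk S * ind 𝒵 S) = pr q 𝒵 - pr q (Hkᶜ ∩ 𝒵) := by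
    simp only [hc, mul_sub, sum_sub_distrib, pr_eq_sum]
  have e3 : ∑ S, bernoulliWeight q S * (ind Hk S * ind 𝒳 S) = pr q 𝒳 - pr q (Hkᶜ ∩ 𝒳) := by
    simp only [hc, mul_sub, sum_sub_distrib, pr_eq_sum]
  have e5 : ∑ S, (∑ T, Kr S T) * ind (𝒳 ∩ 𝒵) S = pr q Hk * pr q (Hkᶜ ∩ (𝒳 ∩ 𝒵)) := by
    calc ∑ S, (∑ T, Kr S T) * ind (𝒳 ∩ 𝒵) S = ∑ S, pr q Hk * (bernoulliWeight q S * ind (Hkᶜ ∩ (𝒳 ∩ 𝒵)) S) := by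
          refine sum_congr rfl fun S _ => ?_
          by_cases h : S ∈ Hk
          · rw [sum_eq_zero fun T _ => hrowH S h T, zero_mul,
              ind_of_not_mem (show S ∉ Hkᶜ ∩ (𝒳 ∩ 𝒵) from fun h' => h'.1 h), mul_zero, mul_zero]
          · rw [hrow S h, ← hii Hkᶜ (𝒳 ∩ 𝒵) S, ind_of_mem (show S ∈ Hkᶜ from h)]; ring
      _ = pr q Hk * pr q (Hkᶜ ∩ (𝒳 ∩ 𝒵)) := by rw [← mul_sum, ← pr_eq_sum]
  have e4 : ∑ S, ∑ T, Kr S T * (ind (𝒳 ∩ 𝒵) T - ind (𝒳 ∩ 𝒵) S) =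
      ∑ S, ∑ T, Kr S T * ind (𝒳 ∩ 𝒵) T - pr q Hk * pr q (Hkᶜ ∩ (𝒳 ∩ 𝒵)) := by
    have : ∀ S, ∑ T, Kr S T * (ind (𝒳 ∩ 𝒵) T - ind (𝒳 ∩ 𝒵) S) = ∑ T, Kr S T * ind (𝒳 ∩ 𝒵) T - (∑ T, Kr S T) * ind (𝒳 ∩ 𝒵) S := by
      intro S; rw [sum_mul, ← sum_sub_distrib]; exact sum_congr rfl fun T _ => by ring
    simp only [this, sum_sub_distrib, e5]
  rw [e1, e2, e3, e4, ← pr_eq_sum, ← pr_eq_sum, ← pr_eq_sum]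
  ring

/-- **A TRANSPORT CERTIFICATE** for the up-set `Hk` of the pattern cube at the parameters `q`: a nonnegative kernel `Π` supported on
`{(S,T) : S ⊆ T, S ∉ Hk, T ∈ Hk}` with row sums `θ·w(S)` (`θ = w(Hk)`), column sums at most `(2 − θ)·w(T)`, satisfying the transport
condition (TC) on every pair of up-sets of the pattern cube. [this work] -/
def TransportCert (q : Fin k → unitInterval) (Hk : Set (Set (Fin k))) (Kr : Set (Fin k) → Set (Fin k) → ℝ) : Prop :=
  (∀ S T, 0 ≤ Kr S T) ∧ (∀ S T, Kr S T ≠ 0 → S ⊆ T) ∧ (∀ S T, Kr S T ≠ 0 → S ∉ Hk) ∧ (∀ S T, Kr S T ≠ 0 → T ∈ Hk) ∧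
  (∀ S, S ∉ Hk → ∑ T, Kr S T = pr q Hk * bernoulliWeight q S) ∧
  (∀ T, ∑ S, Kr S T ≤ (2 - pr q Hk) * bernoulliWeight q T) ∧
  (∀ 𝒳 𝒵 : Set (Set (Fin k)), IsUpperSet 𝒳 → IsUpperSet 𝒵 →
    ∑ S, ∑ T, Kr S T * ind (𝒳 ∩ 𝒵) T ≤
      (2 - pr q Hk) * (pr q (𝒳 ∩ 𝒵) - pr q 𝒳 * pr q 𝒵 - pr q (Hkᶜ ∩ (𝒳 ∩ 𝒵)))
        + pr q 𝒳 * pr q (Hkᶜ ∩ 𝒵) + pr q 𝒵 * pr q (Hkᶜ ∩ 𝒳))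

namespace TransportCert

variable {q : Fin k → unitInterval} {Hk : Set (Set (Fin k))} {Kr : Set (Fin k) → Set (Fin k) → ℝ} (h : TransportCert q Hk Kr)
include h

/-- The kernel is nonnegative. [this work] -/
theorem nonneg (S T : Set (Fin k)) : 0 ≤ Kr S T := h.1 S T
/-- The kernel moves mass upwards. [this work] -/
theorem subset (S T : Set (Fin k)) (hne : Kr S T ≠ 0) : S ⊆ T := h.2.1 S T hne
/-- Sources lie outside `Hk`. [this work] -/
theorem offH (S T : Set (Fin k)) (hne : Kr S T ≠ 0) : S ∉ Hk := h.2.2.1 S T hne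
/-- Targets lie in `Hk`. [this work] -/
theorem memH (S T : Set (Fin k)) (hne : Kr S T ≠ 0) : T ∈ Hk := h.2.2.2.1 S T hne
/-- Row sums: `θ·w(S)` for `S ∉ Hk`. [this work] -/
theorem row (S : Set (Fin k)) (hS : S ∉ Hk) : ∑ T, Kr S T = pr q Hk * bernoulliWeight q S := h.2.2.2.2.1 S hS
/-- Column sums: at most `(2−θ)·w(T)`. [this work] -/
theorem col (T : Set (Fin k)) : ∑ S, Kr S T ≤ (2 - pr q Hk) * bernoulliWeight q T := h.2.2.2.2.2.1 T
/-- The transport condition (TC) on pairs of up-sets. [this work] -/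
theorem tc (𝒳 𝒵 : Set (Set (Fin k))) (h𝒳 : IsUpperSet 𝒳) (h𝒵 : IsUpperSet 𝒵) :
    ∑ S, ∑ T, Kr S T * ind (𝒳 ∩ 𝒵) T ≤
      (2 - pr q Hk) * (pr q (𝒳 ∩ 𝒵) - pr q 𝒳 * pr q 𝒵 - pr q (Hkᶜ ∩ (𝒳 ∩ 𝒵)))
        + pr q 𝒳 * pr q (Hkᶜ ∩ 𝒵) + pr q 𝒵 * pr q (Hkᶜ ∩ 𝒳) := h.2.2.2.2.2.2 𝒳 𝒵 h𝒳 h𝒵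

end TransportCert

/-- Columns outside `Hk` vanish. [this work] -/
theorem TransportCert.memH' {q : Fin k → unitInterval} {Hk : Set (Set (Fin k))} {Kr : Set (Fin k) → Set (Fin k) → ℝ}
    (h : TransportCert q Hk Kr) (S T : Set (Fin k)) (hT : T ∉ Hk) : Kr S T = 0 := by
  by_contra hne; exact hT (h.memH S T hne)

/-- A certificate makes the bilinear remainder nonnegative on increasing nonnegative pattern functions. [this work] -/
theorem TransportCert.remForm_nonneg {q : Fin k → unitInterval} {Hk : Set (Set (Fin k))} {Kr : Set (Fin k) → Set (Fin k) → ℝ}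
    (h : TransportCert q Hk Kr) {f g : Set (Fin k) → ℝ} (hf : Monotone f) (hf0 : ∀ S, 0 ≤ f S) (hg : Monotone g)
    (hg0 : ∀ S, 0 ≤ g S) : 0 ≤ remForm q Hk Kr f g := by
  refine remForm_nonneg_of_ind q Hk Kr (fun 𝒳 𝒵 h𝒳 h𝒵 => ?_) hf hf0 hg hg0
  have hrowH : ∀ S, S ∈ Hk → ∀ T, Kr S T = 0 := fun S hS T => by
    by_contra hne; exact h.offH S T hne hS
  rw [remForm_ind q Hk Kr h.row hrowH]
  linarith [h.tc 𝒳 𝒵 h𝒳 h𝒵]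

/-- **KAHN'S CONJECTURE 5 / SAHI'S `C₃` FOR A CERTIFIED JUNTA SLOT.**  If the pattern event `H_k` of the block-determined increasing event `H`
carries a transport certificate at the block parameters, then `E₃(1_H, 1_U, 1_V) ≥ 0` for ALL increasing events `U, V` of `2^ι` — every
dimension, the other two slots unrestricted. [this work] -/
theorem sahiE_three_nonneg_of_transportCert (p : ι → unitInterval) (e : Fin k ↪ ι) {H : Set (Set ι)}
    (hH : DeterminedBy H (Set.range e)) {Kr : Set (Fin k) → Set (Fin k) → ℝ} (hKr : TransportCert (pk e p) (pat e H) Kr)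
    {U V : Set (Set ι)} (hU : IsUpperSet U) (hV : IsUpperSet V) :
    0 ≤ sahiE (bernoulliWeight p) 3 ![ind H, ind U, ind V] := by
  set q := pk e p with hq
  set Hk := pat e H with hHk
  set θ := pr q Hk with hθ
  set f := fsec p e U with hf
  set g := fsec p e V with hg
  set c := csec p e U V with hc
  have hθ1 : θ ≤ 1 := pr_le_one q Hk
  have hc0 : ∀ S, 0 ≤ c S := fun S => csec_nonneg p e hU hV S
  have hrowH : ∀ S, S ∈ Hk → ∀ T, Kr S T = 0 := fun S hS T => by
    by_contra hne; exact hKr.offH S T hne hS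
  rw [sahiE_three_eq_cubeForm_add p e hH U V]
  change 0 ≤ cubeForm q Hk f g + ∑ S, bernoulliWeight q S * ((2 * ind Hk S - θ) * c S)
  -- (A) split the `c`-terms by membership in `Hk`
  have hA : ∀ S, bernoulliWeight q S * ((2 * ind Hk S - θ) * c S) =
      (2 - θ) * (bernoulliWeight q S * (ind Hk S * c S)) - θ * bernoulliWeight q S * (1 - ind Hk S) * c S := by
    intro S
    by_cases h : S ∈ Hk
    · rw [ind_of_mem h]; ring
    · rw [ind_of_not_mem h]; ring
  -- (B) transport of the negative mass, pattern by pattern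
  have hB : ∀ S, θ * bernoulliWeight q S * (1 - ind Hk S) * c S ≤ ∑ T, Kr S T * (c T + (f T * g T - f S * g S)) := by
    intro S
    by_cases h : S ∈ Hk
    · rw [ind_of_mem h, sum_eq_zero fun T _ => by rw [hrowH S h T, zero_mul]]; simp
    · rw [ind_of_not_mem h, sub_zero, mul_one, ← hKr.row S h, sum_mul]
      refine sum_le_sum fun T _ => ?_
      by_cases hz : Kr S T = 0
      · rw [hz, zero_mul, zero_mul]
      · exact mul_le_mul_of_nonneg_left (csec_le p e hU hV (hKr.subset S T hz)) (hKr.nonneg S T)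
  -- (C) the transported mass is absorbed by the positive `c`-coefficients on `Hk`
  have hC : ∀ T, (∑ S, Kr S T) * c T ≤ (2 - θ) * (bernoulliWeight q T * (ind Hk T * c T)) := by
    intro T
    by_cases h : T ∈ Hk
    · rw [ind_of_mem h, one_mul, ← mul_assoc]
      exact mul_le_mul_of_nonneg_right (hKr.col T) (hc0 T)
    · rw [sum_eq_zero fun S _ => hKr.memH' S T h, zero_mul, ind_of_not_mem h, zero_mul, mul_zero, mul_zero]
  have hsumB : θ * ∑ S, bernoulliWeight q S * (1 - ind Hk S) * c S ≤
      ∑ T, (∑ S, Kr S T) * c T + ∑ S, ∑ T, Kr S T * (f T * g T - f S * g S) := by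
    have h1 : θ * ∑ S, bernoulliWeight q S * (1 - ind Hk S) * c S = ∑ S, θ * bernoulliWeight q S * (1 - ind Hk S) * c S := by
      rw [mul_sum]; exact sum_congr rfl fun S _ => by ring
    have h2 : ∑ T, (∑ S, Kr S T) * c T = ∑ S, ∑ T, Kr S T * c T := by
      rw [sum_comm]; exact sum_congr rfl fun T _ => by rw [sum_mul]
    rw [h1, h2, ← sum_add_distrib]
    refine sum_le_sum fun S _ => ?_
    rw [← sum_add_distrib]
    refine (hB S).trans (le_of_eq (sum_congr rfl fun T _ => by ring))
  have hsumC : ∑ T, (∑ S, Kr S T) * c T ≤ (2 - θ) * ∑ T, bernoulliWeight q T * (ind Hk T * c T) := by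
    rw [mul_sum]; exact sum_le_sum fun T _ => hC T
  have hsplit : ∑ S, bernoulliWeight q S * ((2 * ind Hk S - θ) * c S) =
      (2 - θ) * ∑ S, bernoulliWeight q S * (ind Hk S * c S) - θ * ∑ S, bernoulliWeight q S * (1 - ind Hk S) * c S := by
    rw [sum_congr rfl fun S _ => hA S, sum_sub_distrib, mul_sum, mul_sum]
    congr 1
    exact sum_congr rfl fun S _ => by ring
  have hrem : 0 ≤ remForm q Hk Kr f g :=
    hKr.remForm_nonneg (fsec_mono p e hU) (fun S => pr_nonneg p _) (fsec_mono p e hV) (fun S => pr_nonneg p _)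
  unfold remForm at hrem
  rw [hsplit]
  linarith

end SahiTransportCert

end Summit.CriticalPhenomena.PercolationContinuityZ3.Theorems
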